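import Mathlib
import Literature.MathematicalPhysics.StatisticalMechanics.LennardJonesClusters

/-!
# Ruelle superstability of the truncated Lennard-Jones potential in transfer form

Stub `stub_superstableRedistribution` of the line `sharp-m-potential-compactness` for the crux
`PricedLinkCensus.TruncatedCensusGap` (item stmt-AtomisticToContinuum-14230), registered by
`ledger skeleton check` on `Cruxes/TruncatedCensusGap/Lines/sharp_m_potential_compactness.lean`.
The final statement is the registered signature VERBATIM (self-contained over tree declarations).

`V_χ(r) = min 1 (max 0 (4 - 2r)) · V_LJ(r)`; for a finite configuration `y` let
`n(k) = #{j : |y_j - y_k| < 1/4}` (`k` included; *crowd-free* iff `n = 1`).  The TRANSFER received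
by `i` from `k ≠ i`, `V = V_χ(|y_i - y_k|)`: `τ(i,k) = -V/2` if `V < 0 ∧ n(i) < n(k)`, `= V/2` if
`V < 0 ∧ n(k) < n(i)`, `= 0` otherwise (an attractive pair is charged entirely to its MORE
crowded end point, ties keep the even split); `F_i = Σ_{k ≠ i} τ(i,k)` (INDEX FORM).  The witness
is `ρ = 9/4` with the CLOUD FORM of `F_i`: the same sum over the point set `y(closed 9/4-ball
about y_i)` with the `1/4`-counts taken inside it — so patch-locality is a formality
(`cloud_sum_image`, `cloud_eq_image`), and it equals the index form for injective `y`
(`cloud_sum_eq_global`).  Index form: `Σ_i F_i = 0` by antisymmetry; on a `1/4`-tame `9/4`-patch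
every count met is `1`, so `F_i = 0`; at a crowd-free site a crowd-free partner keeps the even
split, an attractive crowded one is fully discharged, a repulsive one is `≥ 0`; at a crowded
site (`n(i) = m ≥ 2`) the `m - 1` hard-core partners give `≥ 6·10⁵` each (`V_χ = V_LJ ≥ 1.2·10⁶`
on `(0, 1/4)`, injectivity of `y`), and the only negative terms, `≥ -1/12` each, come from
`S = {k : |y_k - y_i| < 2, n(k) ≤ m}`, `#S ≤ 17³ m` by a maximal `1/4`-separated subset and the
packing bound `card_le_of_separated_of_dist_le`.  The rule `t`, the potential `V`, the counts `n`
and `F` enter the lemmas as variables with defining equations as hypotheses (no definitions).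
-/

noncomputable section

namespace Summit.AtomisticToContinuum.Crystallization.Theorems.PricedLinkCensusTruncatedCensusGap

open scoped BigOperators Classical
open Literature.MathematicalPhysics.StatisticalMechanics

/-! ## The truncated potential, the `1/4`-counts, cloud sums -/

/-- `V_χ ≥ -1/12` (the cutoff factor lies in `[0, 1]` and `V_LJ ≥ -1/12`). [folklore] -/
theorem neg_le_truncLJ (r : ℝ) : -1 / 12 ≤ min 1 (max 0 (4 - 2 * r)) * lennardJones r := by
  have h0 : 0 ≤ min 1 (max 0 (4 - 2 * r)) := le_min zero_le_one (le_max_left _ _)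
  have h1 : min 1 (max 0 (4 - 2 * r)) ≤ 1 := min_le_left _ _
  nlinarith [mul_nonneg h0 (by linarith [neg_one_div_le_lennardJones r] :
    0 ≤ lennardJones r + 1 / 12)]

/-- `V_χ(r) = 0` for `r ≥ 2`. [folklore] -/
theorem truncLJ_eq_zero {r : ℝ} (hr : 2 ≤ r) : min 1 (max 0 (4 - 2 * r)) * lennardJones r = 0 := by
  rw [max_eq_left (by linarith : 4 - 2 * r ≤ 0), min_eq_right zero_le_one, zero_mul]

/-- The hard core: `V_χ(r) = V_LJ(r) ≥ 1.2 · 10⁶` for `0 < r < 1/4` (`r⁻⁶ ≥ 4096`). [folklore] -/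
theorem large_truncLJ {r : ℝ} (h0 : 0 < r) (h : r < 1 / 4) :
    1200000 ≤ min 1 (max 0 (4 - 2 * r)) * lennardJones r := by
  rw [min_eq_left (le_max_of_le_right (by linarith : (1 : ℝ) ≤ 4 - 2 * r)), one_mul]
  have h4 : 4 ≤ r⁻¹ := by
    rw [le_inv_comm₀ (by norm_num) h0]
    linarith [show (4 : ℝ)⁻¹ = 1 / 4 by norm_num]
  have hu : (4096 : ℝ) ≤ (r⁻¹) ^ 6 :=
    calc (4096 : ℝ) = 4 ^ 6 := by norm_num
      _ ≤ (r⁻¹) ^ 6 := pow_le_pow_left₀ (by norm_num : (0 : ℝ) ≤ 4) h4 6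
  have h12 : (r⁻¹) ^ 12 = ((r⁻¹) ^ 6) ^ 2 := by ring
  unfold lennardJones
  rw [h12]
  nlinarith [mul_nonneg (sub_nonneg.2 hu) (by linarith : (0 : ℝ) ≤ (r⁻¹) ^ 6 + 4094)]

/-- Every site counts itself: `n(k) ≥ 1`. [folklore] -/
theorem one_le_cnt {N : ℕ} (y : Fin N → EuclideanSpace ℝ (Fin 3)) (k : Fin N) :
    1 ≤ (Finset.univ.filter fun j => dist (y j) (y k) < 1 / 4).card :=
  Finset.card_pos.2 ⟨k, Finset.mem_filter.2 ⟨Finset.mem_univ _, by norm_num⟩⟩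

/-- `n(k) = 1` iff the site `k` is crowd-free at scale `1/4`. [folklore] -/
theorem cnt_eq_one_iff {N : ℕ} (y : Fin N → EuclideanSpace ℝ (Fin 3)) (k : Fin N) :
    (Finset.univ.filter fun j => dist (y j) (y k) < 1 / 4).card = 1 ↔
      ∀ j : Fin N, j ≠ k → 1 / 4 ≤ dist (y j) (y k) := by
  rw [Finset.card_eq_one]
  refine ⟨fun ⟨a, ha⟩ j hjk => ?_, fun h => ⟨k, ?_⟩⟩
  · have hmem : ∀ j', dist (y j') (y k) < 1 / 4 ↔ j' = a := fun j' => by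
      simpa using Finset.ext_iff.1 ha j'
    by_contra hlt
    exact hjk (((hmem j).1 (not_le.mp hlt)).trans ((hmem k).1 (by norm_num)).symm)
  · ext j
    simp only [Finset.mem_filter, Finset.mem_univ, true_and, Finset.mem_singleton]
    refine ⟨fun hj => by_contra fun hjk => (not_le.mpr hj) (h j hjk), ?_⟩
    rintro rfl
    norm_num

/-- **Counting by packing.** The sites of count `≤ m` in the open `2`-ball about `y i` number at
most `17³ · m`: a `1/4`-separated subset `T` of them of maximal size has `#T ≤ 17³`
(`card_le_of_separated_of_dist_le`), and every such site lies within `1/4` of an element of `T`,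
whose `1/4`-ball holds at most `m` sites. [folklore] -/
theorem card_ball_count_le {N : ℕ} (y : Fin N → EuclideanSpace ℝ (Fin 3)) (i : Fin N) (m : ℕ)
    (n : Fin N → ℕ) (hn : ∀ k, n k = (Finset.univ.filter fun j => dist (y j) (y k) < 1 / 4).card) :
    (((Finset.univ.filter fun k => dist (y k) (y i) < 2 ∧ n k ≤ m).card : ℕ) : ℝ) ≤ 4913 * m := by
  set S := Finset.univ.filter fun k => dist (y k) (y i) < 2 ∧ n k ≤ m with hS
  obtain ⟨T, hT, hmax⟩ := Finset.exists_max_image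
    (S.powerset.filter fun T => ∀ a ∈ T, ∀ b ∈ T, a ≠ b → 1 / 4 ≤ dist (y a) (y b))
    Finset.card ⟨∅, by simp⟩
  simp only [Finset.mem_filter, Finset.mem_powerset] at hT hmax
  obtain ⟨hTS, hsep⟩ := hT
  have hTS' : ∀ {a}, a ∈ T → dist (y a) (y i) < 2 ∧ n a ≤ m := fun ha =>
    (Finset.mem_filter.1 (hTS ha)).2
  have hcov : ∀ k ∈ S, ∃ k' ∈ T, dist (y k) (y k') < 1 / 4 := fun k hk => by
    by_contra h
    push Not at h
    have hkT : k ∉ T := fun hkT => by linarith [h k hkT, dist_self (y k)]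
    have := hmax (insert k T) ⟨Finset.insert_subset hk hTS, fun a ha b hb hab => ?_⟩
    · rw [Finset.card_insert_of_notMem hkT] at this
      omega
    rw [Finset.mem_insert] at ha hb
    rcases ha with rfl | ha <;> rcases hb with rfl | hb
    · exact absurd rfl hab
    · exact h b hb
    · rw [dist_comm]; exact h a ha
    · exact hsep a ha b hb hab
  have hsub : S ⊆ T.biUnion fun k' => Finset.univ.filter fun j => dist (y j) (y k') < 1 / 4 :=
    fun k hk => by
      obtain ⟨k', hk', hd⟩ := hcov k hk
      exact Finset.mem_biUnion.2 ⟨k', hk', Finset.mem_filter.2 ⟨Finset.mem_univ _, hd⟩⟩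
  have h1 : S.card ≤ T.card * m := by
    refine (Finset.card_le_card hsub).trans (Finset.card_biUnion_le.trans ?_)
    rw [← smul_eq_mul, ← Finset.sum_const]
    exact Finset.sum_le_sum fun a ha => by rw [← hn]; exact (hTS' ha).2
  have h2 : (T.card : ℝ) ≤ 4913 := by
    have hinj : Set.InjOn y T := fun a ha b hb hab => by
      by_contra hne
      have := hsep a ha b hb hne
      rw [hab, dist_self] at this
      linarith
    have h := card_le_of_separated_of_dist_le (T.image y) (y i) (by norm_num : (0 : ℝ) < 1 / 4)
      (by norm_num : (0 : ℝ) ≤ 2) ?_ ?_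
    · rw [finrank_euclideanSpace_fin, Finset.card_image_of_injOn hinj] at h
      norm_num at h
      exact_mod_cast h
    all_goals simp only [Finset.mem_image]
    · rintro _ ⟨a, ha, rfl⟩
      exact le_of_lt (hTS' ha).1
    · rintro _ ⟨a, ha, rfl⟩ _ ⟨b, hb, rfl⟩ hab
      exact hsep a ha b hb fun h => hab (by rw [h])
  calc ((S.card : ℕ) : ℝ) ≤ ((T.card * m : ℕ) : ℝ) := by exact_mod_cast h1
    _ ≤ 4913 * m := by push_cast; exact mul_le_mul_of_nonneg_right h2 (Nat.cast_nonneg m)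

/-- A cloud sum (over a finite point set `P`, of a function of the distance to the root `p₀` and of
the `1/4`-counts of `P` at the root and at the point) is invariant under isometries. [folklore] -/
theorem cloud_sum_image (φ : ℝ → ℕ → ℕ → ℝ) (P : Finset (EuclideanSpace ℝ (Fin 3)))
    (p₀ : EuclideanSpace ℝ (Fin 3)) (g : EuclideanSpace ℝ (Fin 3) ≃ᵃⁱ[ℝ] EuclideanSpace ℝ (Fin 3)) :
    ∑ p ∈ P.image g, φ (dist (g p₀) p) (((P.image g).filter fun q => dist q (g p₀) < 1 / 4).card)
        (((P.image g).filter fun q => dist q p < 1 / 4).card) =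
      ∑ p ∈ P, φ (dist p₀ p) ((P.filter fun q => dist q p₀ < 1 / 4).card)
        ((P.filter fun q => dist q p < 1 / 4).card) := by
  have hc : ∀ q₀ : EuclideanSpace ℝ (Fin 3),
      ((P.image g).filter fun q => dist q (g q₀) < 1 / 4).card =
        (P.filter fun q => dist q q₀ < 1 / 4).card := fun q₀ => by
    rw [Finset.filter_image, Finset.card_image_of_injective _ g.injective]
    exact congrArg Finset.card (Finset.filter_congr fun a _ => by rw [g.dist_map])
  rw [Finset.sum_image g.injective.injOn]
  exact Finset.sum_congr rfl fun p _ => by rw [g.dist_map, hc, hc]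

/-- Under the hypotheses of patch-locality at radius `9/4`, the point cloud of `y'` in the closed
`9/4`-ball about `y' i'` is the image under `g` of that of `y` about `y i`. [folklore] -/
theorem cloud_eq_image {N N' : ℕ} (y : Fin N → EuclideanSpace ℝ (Fin 3))
    (y' : Fin N' → EuclideanSpace ℝ (Fin 3)) (i : Fin N) (i' : Fin N')
    (g : EuclideanSpace ℝ (Fin 3) ≃ᵃⁱ[ℝ] EuclideanSpace ℝ (Fin 3)) (hg : g (y i) = y' i')
    (h1 : ∀ j : Fin N, dist (y j) (y i) ≤ 9 / 4 → g (y j) ∈ Set.range y')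
    (h2 : ∀ j' : Fin N', dist (y' j') (y' i') ≤ 9 / 4 → y' j' ∈ g '' Set.range y) :
    (Finset.univ.filter fun k' => dist (y' k') (y' i') ≤ 9 / 4).image y' =
      ((Finset.univ.filter fun k => dist (y k) (y i) ≤ 9 / 4).image y).image g := by
  ext p
  simp only [Finset.mem_image, Finset.mem_filter, Finset.mem_univ, true_and]
  constructor
  · rintro ⟨k', hk', rfl⟩
    obtain ⟨x, ⟨k, rfl⟩, hk⟩ := h2 k' hk'
    refine ⟨y k, ⟨k, ?_, rfl⟩, hk⟩
    rw [← g.dist_map, hk, hg]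
    exact hk'
  · rintro ⟨x, ⟨k, hk, rfl⟩, rfl⟩
    obtain ⟨k', hk'⟩ := h1 k hk
    refine ⟨k', ?_, hk'⟩
    rw [hk', ← hg, g.dist_map]
    exact hk

/-! ## The transfer rule, the index form, and the reduction of the cloud form to it -/

section Transfer

variable (t : ℝ → ℕ → ℕ → ℝ) (ht : ∀ v a b, t v a b =
  if v < 0 then (if a < b then -v / 2 else if b < a then v / 2 else 0) else 0)
include ht

/-- **Reduction to the index form.** For injective `y` the cloud form of `F_i` (over the
`9/4`-cloud, counts inside the cloud) equals the index form `Σ_{k ≠ i} τ(i,k)` with the GLOBAL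
`1/4`-counts: `V_χ = 0` beyond `2`, and the `1/4`-ball of a partner closer than `2` lies in the
`9/4`-ball. [folklore] -/
theorem cloud_sum_eq_global {N : ℕ} (y : Fin N → EuclideanSpace ℝ (Fin 3))
    (hy : Function.Injective y) (i : Fin N) :
    ∑ p ∈ (Finset.univ.filter fun k => dist (y k) (y i) ≤ 9 / 4).image y,
        t (min 1 (max 0 (4 - 2 * dist (y i) p)) * lennardJones (dist (y i) p))
          ((((Finset.univ.filter fun k => dist (y k) (y i) ≤ 9 / 4).image y).filter
            fun q => dist q (y i) < 1 / 4).card)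
          ((((Finset.univ.filter fun k => dist (y k) (y i) ≤ 9 / 4).image y).filter
            fun q => dist q p < 1 / 4).card) =
      ∑ k ∈ Finset.univ.erase i,
        t (min 1 (max 0 (4 - 2 * dist (y i) (y k))) * lennardJones (dist (y i) (y k)))
          ((Finset.univ.filter fun j => dist (y j) (y i) < 1 / 4).card)
          ((Finset.univ.filter fun j => dist (y j) (y k) < 1 / 4).card) := by
  have h0 : ∀ {d : ℝ} (a b : ℕ), 2 ≤ d → t (min 1 (max 0 (4 - 2 * d)) * lennardJones d) a b = 0 :=
    fun a b hd => by rw [truncLJ_eq_zero hd, ht, if_neg (lt_irrefl 0)]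
  set A := Finset.univ.filter fun k => dist (y k) (y i) ≤ 9 / 4 with hA
  have hcnt : ∀ k, dist (y k) (y i) ≤ 2 → ((A.image y).filter fun q => dist q (y k) < 1 / 4).card =
      (Finset.univ.filter fun j => dist (y j) (y k) < 1 / 4).card := fun k hk => by
    rw [Finset.filter_image, Finset.card_image_of_injective _ hy, hA, Finset.filter_filter]
    exact congrArg Finset.card (Finset.filter_congr fun j _ =>
      ⟨And.right, fun h => ⟨by linarith [dist_triangle (y j) (y k) (y i)], h⟩⟩)
  rw [Finset.sum_image hy.injOn, hcnt i (by norm_num)]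
  refine (Finset.sum_congr rfl fun k _ => ?_).trans ((Finset.sum_subset (Finset.subset_univ A)
    fun k _ hk => h0 _ _ ?_).trans (Finset.sum_erase _ (by rw [ht]; simp)).symm)
  · by_cases hd : dist (y i) (y k) < 2
    · rw [hcnt k (by rw [dist_comm]; exact hd.le)]
    · rw [h0 _ _ (not_lt.mp hd), h0 _ _ (not_lt.mp hd)]
  · rw [hA, Finset.mem_filter, not_and] at hk
    linarith [not_le.mp (hk (Finset.mem_univ _)), dist_comm (y i) (y k)]

/-- **Null Lagrangian.** `Σ_i Σ_{k ≠ i} τ(i,k) = 0`, by antisymmetry of `τ`. [folklore] -/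
theorem global_sum_eq_zero {N : ℕ} (y : Fin N → EuclideanSpace ℝ (Fin 3)) (V : ℝ → ℝ)
    (n : Fin N → ℕ) : ∑ i, ∑ k ∈ Finset.univ.erase i, t (V (dist (y i) (y k))) (n i) (n k) = 0 := by
  have hS : ∑ i, ∑ k, t (V (dist (y i) (y k))) (n i) (n k) =
      -∑ i, ∑ k, t (V (dist (y i) (y k))) (n i) (n k) := by
    conv_lhs => rw [Finset.sum_comm]
    rw [← Finset.sum_neg_distrib]
    refine Finset.sum_congr rfl fun k _ => ?_
    rw [← Finset.sum_neg_distrib]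
    refine Finset.sum_congr rfl fun i _ => ?_
    rw [dist_comm (y k) (y i), ht, ht]
    split_ifs <;> first | omega | ring
  have hsq : ∑ i, ∑ k ∈ Finset.univ.erase i, t (V (dist (y i) (y k))) (n i) (n k) =
      ∑ i, ∑ k, t (V (dist (y i) (y k))) (n i) (n k) :=
    Finset.sum_congr rfl fun i _ => Finset.sum_erase _ (by rw [ht]; simp)
  linarith

/-- **Tame patches.** If the sites of the closed `9/4`-ball about `y i` are `1/4`-separated, then
every count met by an active transfer at `i` equals `1`, so `F_i = 0`. [folklore] -/
theorem global_eq_zero_of_tame {N : ℕ} (y : Fin N → EuclideanSpace ℝ (Fin 3)) (V : ℝ → ℝ)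
    (hV : ∀ r, V r = min 1 (max 0 (4 - 2 * r)) * lennardJones r) (n : Fin N → ℕ)
    (hn : ∀ k, n k = (Finset.univ.filter fun j => dist (y j) (y k) < 1 / 4).card) (i : Fin N)
    (htame : ∀ j k : Fin N, j ≠ k → dist (y j) (y i) ≤ 9 / 4 → dist (y k) (y i) ≤ 9 / 4 →
      1 / 4 ≤ dist (y j) (y k)) :
    ∑ k ∈ Finset.univ.erase i, t (V (dist (y i) (y k))) (n i) (n k) = 0 := by
  refine Finset.sum_eq_zero fun k _ => ?_
  by_cases hneg : V (dist (y i) (y k)) < 0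
  · have hd : dist (y k) (y i) < 2 := by
      rw [dist_comm]
      exact not_le.mp fun h' => hneg.ne (by rw [hV, truncLJ_eq_zero h'])
    have hcnt : ∀ k', dist (y k') (y i) < 2 → n k' = 1 := fun k' hk' => by
      rw [hn, cnt_eq_one_iff]
      intro j hj
      by_contra hlt
      exact hlt (htame j k' hj (by linarith [dist_triangle (y j) (y k') (y i), not_le.mp hlt])
        (by linarith))
    rw [ht, hcnt i (by norm_num), hcnt k hd]
    simp
  · rw [ht, if_neg hneg]

/-- **Crowd-free sites.** At a crowd-free site `f i` (`f` enumerating exactly the crowd-free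
sites), `e/2 + F` dominates half the site energy of `i` in the sub-configuration `y ∘ f`: a
crowd-free partner keeps the even split, an attractive crowded partner is fully discharged, a
repulsive one contributes `≥ 0`. [folklore] -/
theorem sub_le_global {N M : ℕ} (y : Fin N → EuclideanSpace ℝ (Fin 3)) (V : ℝ → ℝ)
    (n : Fin N → ℕ) (hn : ∀ k, n k = (Finset.univ.filter fun j => dist (y j) (y k) < 1 / 4).card)
    (f : Fin M ↪ Fin N) (i : Fin M)
    (hf : ∀ k : Fin N, k ∈ Set.range f ↔ ∀ k' : Fin N, k' ≠ k → 1 / 4 ≤ dist (y k') (y k)) :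
    siteEnergy V (y ∘ f) i / 2 ≤ siteEnergy V y (f i) / 2 +
      ∑ k ∈ Finset.univ.erase (f i), t (V (dist (y (f i)) (y k))) (n (f i)) (n k) := by
  have hrange : ∀ k, k ∈ Set.range f ↔ n k = 1 := fun k => by rw [hf, hn, cnt_eq_one_iff]
  have hset : (Finset.univ.erase i).map f = (Finset.univ.erase (f i)).filter fun k => n k = 1 := by
    ext k
    simp only [Finset.mem_map, Finset.mem_erase, ne_eq, Finset.mem_univ, and_true,
      Finset.mem_filter, ← hrange, Set.mem_range]
    constructor
    · rintro ⟨a, ha, rfl⟩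
      exact ⟨fun h => ha (f.injective h), a, rfl⟩
    · rintro ⟨hk, a, rfl⟩
      exact ⟨a, fun h => hk (by rw [h]), rfl⟩
  calc siteEnergy V (y ∘ f) i / 2
      = ∑ k ∈ (Finset.univ.erase i).map f, V (dist (y (f i)) (y k)) / 2 := by
        rw [siteEnergy, Finset.sum_map, Finset.sum_div]
        rfl
    _ ≤ ∑ k ∈ Finset.univ.erase (f i),
          (V (dist (y (f i)) (y k)) / 2 + t (V (dist (y (f i)) (y k))) (n (f i)) (n k)) := by
        rw [hset, Finset.sum_filter]
        refine Finset.sum_le_sum fun k _ => ?_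
        have h1 := one_le_cnt y k
        rw [← hn] at h1
        rw [(hrange _).1 ⟨i, rfl⟩, ht]
        split_ifs <;> first | linarith | omega
    _ = _ := by rw [siteEnergy, Finset.sum_add_distrib, Finset.sum_div]

/-- **Crowded sites.** At a site of count `m ≥ 2` the `m - 1` hard-core partners contribute
`≥ 6 · 10⁵` each to `e/2 + F` (first summand of the termwise bound below); the only negative
terms, `≥ -1/12` each, come from the `≤ 17³ · m` attractive partners of count `≤ m` closer than
`2` (second summand); hence `e/2 + F ≥ 1`. [folklore] -/
theorem one_le_global {N : ℕ} (y : Fin N → EuclideanSpace ℝ (Fin 3)) (hy : Function.Injective y)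
    (V : ℝ → ℝ) (hV : ∀ r, V r = min 1 (max 0 (4 - 2 * r)) * lennardJones r) (n : Fin N → ℕ)
    (hn : ∀ k, n k = (Finset.univ.filter fun j => dist (y j) (y k) < 1 / 4).card) (i : Fin N)
    (hcrowd : ¬ ∀ k : Fin N, k ≠ i → 1 / 4 ≤ dist (y k) (y i)) :
    1 ≤ siteEnergy V y i / 2 + ∑ k ∈ Finset.univ.erase i, t (V (dist (y i) (y k))) (n i) (n k) := by
  set m := n i with hm
  have hm2 : 2 ≤ m := by
    have h1 : 1 ≤ m := by rw [hm, hn]; exact one_le_cnt y i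
    have hne : m ≠ 1 := fun h => hcrowd ((cnt_eq_one_iff y i).1 (by rw [← hn]; exact h))
    omega
  have key : ∀ k ∈ Finset.univ.erase i,
      600000 * (if dist (y k) (y i) < 1 / 4 then (1 : ℝ) else 0) -
          1 / 12 * (if dist (y k) (y i) < 2 ∧ n k ≤ m then (1 : ℝ) else 0) ≤
        V (dist (y i) (y k)) / 2 + t (V (dist (y i) (y k))) m (n k) := fun k hk => by
    have hv : -1 / 12 ≤ V (dist (y i) (y k)) := by rw [hV]; exact neg_le_truncLJ _
    rw [ht, dist_comm (y k) (y i)]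
    by_cases hp : dist (y i) (y k) < 1 / 4
    · have hv' : 1200000 ≤ V (dist (y i) (y k)) := by
        rw [hV]
        exact large_truncLJ (dist_pos.2 (hy.ne (Finset.ne_of_mem_erase hk)).symm) hp
      rw [if_pos hp, if_neg (show ¬ V (dist (y i) (y k)) < 0 by linarith)]
      split_ifs <;> linarith
    · have h2 : V (dist (y i) (y k)) < 0 → dist (y i) (y k) < 2 := fun h =>
        not_le.mp fun h' => h.ne (by rw [hV, truncLJ_eq_zero h'])
      rw [if_neg hp]
      split_ifs <;> first | linarith | exact absurd ⟨h2 ‹_›, by omega⟩ ‹¬(_ ∧ _)›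
  have hsum := Finset.sum_le_sum key
  rw [Finset.sum_sub_distrib, ← Finset.mul_sum, ← Finset.mul_sum, Finset.sum_boole,
    Finset.sum_boole] at hsum
  have hclose : ((((Finset.univ.erase i).filter fun k => dist (y k) (y i) < 1 / 4).card : ℕ) : ℝ)
      = m - 1 := by
    rw [eq_sub_iff_add_eq, ← Nat.cast_add_one, Finset.filter_erase,
      Finset.card_erase_add_one (Finset.mem_filter.2 ⟨Finset.mem_univ _, by norm_num⟩), hm, hn]
  have hS : ((((Finset.univ.erase i).filter fun k => dist (y k) (y i) < 2 ∧ n k ≤ m).card : ℕ) : ℝ)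
      ≤ 4913 * m := by
    refine le_trans ?_ (card_ball_count_le y i m n hn)
    exact_mod_cast Finset.card_le_card
      (Finset.filter_subset_filter _ (Finset.erase_subset i Finset.univ))
  rw [siteEnergy, Finset.sum_div, ← Finset.sum_add_distrib]
  linarith [show (2 : ℝ) ≤ m by exact_mod_cast hm2]

end Transfer

/-- **Ruelle superstability of `V_χ` in transfer form** (registered signature, line
`sharp-m-potential-compactness` of `PricedLinkCensus.TruncatedCensusGap`): a radius `ρ` (`= 9/4`)
and a patch-local null-Lagrangian site functional `F` (cloud form of the transfer "charge each
attractive pair to its more crowded end point"), vanishing on `1/4`-tame patches, with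
`e_i/2 + F_i ≥ 1` at every `1/4`-crowded site and `e_i/2 + F_i ≥` the half site energy of `i` in
the crowd-free sub-configuration at every crowd-free site. [folklore] -/
theorem stub_superstableRedistribution :
    ∃ (ρ : ℝ) (F : (N : ℕ) → (Fin N → EuclideanSpace ℝ (Fin 3)) → Fin N → ℝ),
      (∀ (N N' : ℕ) (y : Fin N → EuclideanSpace ℝ (Fin 3)) (y' : Fin N' → EuclideanSpace ℝ (Fin 3))
          (i : Fin N) (i' : Fin N')
          (g : EuclideanSpace ℝ (Fin 3) ≃ᵃⁱ[ℝ] EuclideanSpace ℝ (Fin 3)),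
        Function.Injective y → Function.Injective y' → g (y i) = y' i' →
        (∀ j : Fin N, dist (y j) (y i) ≤ ρ → g (y j) ∈ Set.range y') →
        (∀ j' : Fin N', dist (y' j') (y' i') ≤ ρ → y' j' ∈ g '' Set.range y) →
        F N y i = F N' y' i') ∧
      (∀ (N : ℕ) (y : Fin N → EuclideanSpace ℝ (Fin 3)), Function.Injective y → ∑ i, F N y i = 0) ∧
      (∀ (N : ℕ) (y : Fin N → EuclideanSpace ℝ (Fin 3)) (i : Fin N), Function.Injective y →
        (∀ j k : Fin N, j ≠ k → dist (y j) (y i) ≤ ρ → dist (y k) (y i) ≤ ρ →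
          1 / 4 ≤ dist (y j) (y k)) →
        F N y i = 0) ∧
      (∀ (N M : ℕ) (y : Fin N → EuclideanSpace ℝ (Fin 3)) (f : Fin M ↪ Fin N) (i : Fin M),
        Function.Injective y →
        (∀ k : Fin N, k ∈ Set.range f ↔ ∀ k' : Fin N, k' ≠ k → 1 / 4 ≤ dist (y k') (y k)) →
        siteEnergy (fun r => min 1 (max 0 (4 - 2 * r)) * lennardJones r) (y ∘ f) i / 2 ≤
          siteEnergy (fun r => min 1 (max 0 (4 - 2 * r)) * lennardJones r) y (f i) / 2
            + F N y (f i)) ∧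
      (∀ (N : ℕ) (y : Fin N → EuclideanSpace ℝ (Fin 3)) (i : Fin N), Function.Injective y →
        ¬ (∀ k : Fin N, k ≠ i → 1 / 4 ≤ dist (y k) (y i)) →
        1 ≤ siteEnergy (fun r => min 1 (max 0 (4 - 2 * r)) * lennardJones r) y i / 2 + F N y i) := by
  obtain ⟨t, ht⟩ : ∃ t : ℝ → ℕ → ℕ → ℝ, ∀ v a b, t v a b =
      if v < 0 then (if a < b then -v / 2 else if b < a then v / 2 else 0) else 0 :=
    ⟨fun v a b => if v < 0 then (if a < b then -v / 2 else if b < a then v / 2 else 0) else 0,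
      fun _ _ _ => rfl⟩
  obtain ⟨F, hF⟩ : ∃ F : (N : ℕ) → (Fin N → EuclideanSpace ℝ (Fin 3)) → Fin N → ℝ,
      ∀ N y i, F N y i = ∑ p ∈ (Finset.univ.filter fun k => dist (y k) (y i) ≤ 9 / 4).image y,
        t (min 1 (max 0 (4 - 2 * dist (y i) p)) * lennardJones (dist (y i) p))
          ((((Finset.univ.filter fun k => dist (y k) (y i) ≤ 9 / 4).image y).filter
            fun q => dist q (y i) < 1 / 4).card)
          ((((Finset.univ.filter fun k => dist (y k) (y i) ≤ 9 / 4).image y).filter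
            fun q => dist q p < 1 / 4).card) := ⟨fun N y i => _, fun _ _ _ => rfl⟩
  refine ⟨9 / 4, F, fun N N' y y' i i' g _ _ hg h1 h2 => ?_, fun N y hy => ?_,
    fun N y i hy htame => ?_, fun N M y f i hy hf => ?_, fun N y i hy hcrowd => ?_⟩
  · rw [hF, hF, cloud_eq_image y y' i i' g hg h1 h2, ← hg]
    exact (cloud_sum_image (fun d a b => t (min 1 (max 0 (4 - 2 * d)) * lennardJones d) a b)
      _ (y i) g).symm
  · rw [Finset.sum_congr rfl fun i _ => (hF N y i).trans (cloud_sum_eq_global t ht y hy i)]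
    exact global_sum_eq_zero t ht y (fun r => min 1 (max 0 (4 - 2 * r)) * lennardJones r)
      fun k => (Finset.univ.filter fun j => dist (y j) (y k) < 1 / 4).card
  · rw [hF, cloud_sum_eq_global t ht y hy i]
    exact global_eq_zero_of_tame t ht y _ (fun _ => rfl) _ (fun _ => rfl) i htame
  · rw [hF, cloud_sum_eq_global t ht y hy (f i)]
    exact sub_le_global t ht y _ _ (fun _ => rfl) f i hf
  · rw [hF, cloud_sum_eq_global t ht y hy i]
    exact one_le_global t ht y hy _ (fun _ => rfl) _ (fun _ => rfl) i hcrowd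

end Summit.AtomisticToContinuum.Crystallization.Theorems.PricedLinkCensusTruncatedCensusGap

end
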